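import Summits.BirchSwinnertonDyer.Rank1Residual.Additive.ZpTowerSelmerTransport
import Summits.BirchSwinnertonDyer.Rank1Residual.Additive.InfiniteCompletionGaloisConj
import HarnessLib

/-!
# T-res (second half), file F: `kerH1Iso` carries `Sel_{p^∞}(E_{K_n}/K_{n,∞})` into
# `Sel_{p^∞}(E/K_∞)` — the archimedean places and the assembly (cell `b2b-bsdres`, n1011, p17 GEN 4;
# r2 ROUTE-2 §II.17.7 T-res, row T-E3g-BUDn-K second half)

HONEST FRAMING (cell `b2b-bsdres`, verbatim in every file): prove what is provable now; nothing is
booked; no label changes. ONE definition (the restricted map on Selmer groups) + THEOREMS; NO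
Literature fact; no `sorry`; no parity hypothesis on `p`.

For a `ℤ_p`-extension `κ` of a number field `K`, a layer `K_n`, a restricted tower `κ_n` (`hκn`)
and p01's `kerH1Iso : H¹(ker κ_n, E_{K_n}[p^∞]) ≃+ H¹(ker κ, E[p^∞])` (`Additive/ZpTowerKernelH1`):

* `kerH1Iso_mem_localKerOverOfEmb_infinitePlace` / `conjH1_kerH1Iso_mem_localKerOver_infinitePlace` :
  the archimedean local conditions (the generic local step of file D with Mathlib's completions at
  infinite places and file E's `exists_infinitePlace_factorisation`);
* `kerH1Iso_mem_selmerGroupOver` (p01's exact signature, skel §5):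
  `x ∈ Sel_{p^∞}(E_{K_n}/K_{n,∞}) → kerH1Iso x ∈ Sel_{p^∞}(E/K_∞)`;
* `selmerInftyOfRestrictTower` : the induced INJECTIVE homomorphism
  `(W.baseChange K_n).selmerInfty κ_n →+ W.selmerInfty κ`, and
  `exists_selmerInfty_restrictTower_injective` — r2's T-res in the shape consumed by p10's
  `budgetLeLambdaAt_layer_of_tamagawaWitnesses` (`hres`), with `ZpTower.exists_restrictTower`.

References: [Mazur1972] §6; [GreenbergLNM1716] §2; [SerreGaloisCohomology1997] II.§1.1.
-/

noncomputable section

open scoped Classical NumberField.LiesOver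

open Literature.NumberTheory.EllipticCurves NumberField IsDedekindDomain
open Summit.BirchSwinnertonDyer.Rank1Residual.Additive.LocalTransport

universe u

namespace Summit.BirchSwinnertonDyer.Rank1Residual.Additive.ZpTower

variable {K : Type u} [Field K] [NumberField K] {p : ℕ} [Fact p.Prime]
variable (W : WeierstrassCurve K) (κ : ZpExtension K p) (n : ℕ) (κn : ZpExtension (κ.layer n) p)
  (hκn : ∀ σ : Field.absoluteGaloisGroup (κ.layer n),
    (κn σ).toAdd * (p : ℤ_[p]) ^ n = (κ (resGal (K := K) (κ.layer n) σ)).toAdd)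

/-! ## Archimedean places -/

/-- **Infinite places.** For `x ∈ Sel_{p^∞}(E_{K_n}/K_{n,∞})`, every infinite place `v` of `K`
and EVERY `K`-embedding `ι : K̄ → K̄_v`, `kerH1Iso x` dies in `H¹((res_ι)⁻¹(ker κ), E(K̄_v))`:
the generic local step with `E' = K_{n,w}`, `w ∣ v` from `exists_infinitePlace_factorisation`.
[cite: GreenbergLNM1716, §2] -/
theorem kerH1Iso_mem_localKerOverOfEmb_infinitePlace (v : InfinitePlace K)
    (ι : AlgebraicClosure K →ₐ[K] AlgebraicClosure v.Completion)
    (x : (W.baseChange (κ.layer n)).subgroupH1 p κn.kerSubgroup)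
    (hx : x ∈ (W.baseChange (κ.layer n)).selmerGroupOver p κn.kerSubgroup) :
    kerH1Iso W κ n κn hκn x ∈ W.localKerOverOfEmb p κ.kerSubgroup ι := by
  let ιL : AlgebraicClosure K ≃ₐ[K] AlgebraicClosure (κ.layer n) :=
    algEquivOfEmb (κ.layer n) (closureEmb (K := K) (κ.layer n))
  let φ : κ.layer n →+* AlgebraicClosure v.Completion :=
    ι.toRingHom.comp ((ιL.symm : AlgebraicClosure (κ.layer n) →+* AlgebraicClosure K).comp
      (algebraMap (κ.layer n) (AlgebraicClosure (κ.layer n))))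
  have hφapply : ∀ l, φ l = ι (ιL.symm (algebraMap (κ.layer n) (AlgebraicClosure (κ.layer n)) l)) :=
    fun _ ↦ rfl
  have hφ : φ.comp (algebraMap K (κ.layer n)) =
      (algebraMap v.Completion (AlgebraicClosure v.Completion)).comp
        (algebraMap K v.Completion) := by
    ext x
    change φ (algebraMap K (κ.layer n) x) =
      algebraMap v.Completion _ (algebraMap K v.Completion x)
    rw [hφapply, ← IsScalarTower.algebraMap_apply K (κ.layer n) (AlgebraicClosure (κ.layer n)),
      AlgEquiv.commutes, AlgHom.commutes, ← IsScalarTower.algebraMap_apply]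
  obtain ⟨w, hw, ε, hεf, hεφ⟩ := exists_infinitePlace_factorisation (κ.layer n) v
    (algebraMap v.Completion (AlgebraicClosure v.Completion)) φ hφ
  haveI : IsScalarTower K (κ.layer n) w.Completion := isScalarTower_completion (κ.layer n) w
  exact kerH1Iso_mem_localKerOverOfEmb_of_factorisation W κ n κn hκn ι
    (NumberField.LiesOver.completionMap (v := v) (w := w)) ε hεf
    (fun l ↦ (RingHom.congr_fun hεφ l).trans (hφapply l))
    (closure_range_completionMap_union_eq_top (κ.layer n) v w) x
    (fun σ ↦ (((W.baseChange (κ.layer n)).mem_selmerGroupOver_iff p κn.kerSubgroup x).1 hx).2 w σ)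

/-- The same in the `conj_σ` form of `mem_selmerGroupOver_iff` at the infinite places.
[cite: GreenbergLNM1716, §2] -/
theorem conjH1_kerH1Iso_mem_localKerOver_infinitePlace (v : InfinitePlace K)
    (σ : Field.absoluteGaloisGroup K)
    (x : (W.baseChange (κ.layer n)).subgroupH1 p κn.kerSubgroup)
    (hx : x ∈ (W.baseChange (κ.layer n)).selmerGroupOver p κn.kerSubgroup) :
    W.conjH1 p κ.kerSubgroup σ (kerH1Iso W κ n κn hκn x) ∈
      W.localKerOver p κ.kerSubgroup v.Completion := by
  have h := kerH1Iso_mem_localKerOverOfEmb_infinitePlace W κ n κn hκn v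
    ((closureEmb (K := K) v.Completion).comp
      ((show AlgebraicClosure K ≃ₐ[K] AlgebraicClosure K from σ) :
        AlgebraicClosure K →ₐ[K] AlgebraicClosure K)) x hx
  rw [W.localKerOverOfEmb_comp p κ.kerSubgroup, AddSubgroup.mem_comap] at h
  rw [WeierstrassCurve.localKerOver_eq_ofEmb]
  exact h

/-! ## The Selmer group over the top of the restricted tower maps into the one over `K_∞` -/

/-- **T-res, second half (p01's signature).** `kerH1Iso` carries `Sel_{p^∞}(E_{K_n}/K_{n,∞})`
(Selmer conditions at all places of `K_n`, all `Γ_{K_n}`-conjugates) into `Sel_{p^∞}(E/K_∞)`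
(conditions at all places of `K`, all `Γ_K`-conjugates): both fields are the same field `K_∞`,
and every local condition over `K` at a `K`-embedding `K̄ → K̄_v` is accounted for by a place of
`K_n` above `v` (files B/E) and transported along `kerH1Iso` (files C/D).
[cite: Mazur1972, §6] -/
theorem kerH1Iso_mem_selmerGroupOver (x : (W.baseChange (κ.layer n)).subgroupH1 p κn.kerSubgroup)
    (hx : x ∈ (W.baseChange (κ.layer n)).selmerGroupOver p κn.kerSubgroup) :
    kerH1Iso W κ n κn hκn x ∈ W.selmerGroupOver p κ.kerSubgroup := by
  rw [WeierstrassCurve.mem_selmerGroupOver_iff]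
  exact ⟨fun v σ ↦ conjH1_kerH1Iso_mem_localKerOver_adicCompletion W κ n κn hκn v σ x hx,
    fun v σ ↦ conjH1_kerH1Iso_mem_localKerOver_infinitePlace W κ n κn hκn v σ x hx⟩

/-- `kerH1Iso` maps `selmerInfty` of the restricted tower into `selmerInfty` of `κ`
(`WeierstrassCurve.selmerInfty W κ = W.selmerGroupOver p (ker κ)`). [cite: Mazur1972, §6] -/
theorem kerH1Iso_mem_selmerInfty (x : (W.baseChange (κ.layer n)).subgroupH1 p κn.kerSubgroup)
    (hx : x ∈ (W.baseChange (κ.layer n)).selmerInfty κn) :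
    kerH1Iso W κ n κn hκn x ∈ W.selmerInfty κ :=
  kerH1Iso_mem_selmerGroupOver W κ n κn hκn x hx

/-- **The transport map on Selmer groups**
`Sel_{p^∞}(E_{K_n}/K_{n,∞}) →+ Sel_{p^∞}(E/K_∞)`: `kerH1Iso` restricted and corestricted.
[cite: Mazur1972, §6] -/
def selmerInftyOfRestrictTower : (W.baseChange (κ.layer n)).selmerInfty κn →+ W.selmerInfty κ :=
  ((kerH1Iso W κ n κn hκn).toAddMonoidHom.comp
      ((W.baseChange (κ.layer n)).selmerInfty κn).subtype).codRestrict (W.selmerInfty κ)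
    fun x ↦ kerH1Iso_mem_selmerInfty W κ n κn hκn x x.2

/-- Values of `selmerInftyOfRestrictTower`. [folklore] -/
@[simp]
theorem coe_selmerInftyOfRestrictTower_apply (x : (W.baseChange (κ.layer n)).selmerInfty κn) :
    ((selmerInftyOfRestrictTower W κ n κn hκn x : W.selmerInfty κ) :
        W.subgroupH1 p κ.kerSubgroup) = kerH1Iso W κ n κn hκn x :=
  rfl

/-- `selmerInftyOfRestrictTower` is injective (`kerH1Iso` is). [cite: Mazur1972, §6] -/
theorem selmerInftyOfRestrictTower_injective :
    Function.Injective (selmerInftyOfRestrictTower W κ n κn hκn) := by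
  intro x y h
  apply Subtype.ext
  apply (kerH1Iso W κ n κn hκn).injective
  exact congrArg (fun z : W.selmerInfty κ ↦ (z : W.subgroupH1 p κ.kerSubgroup)) h

/-- **r2's T-res** (`route2/g11/BUDnSeamCheck.lean`, ROUTE-2 §II.17.7), in the shape consumed by
p10's `budgetLeLambdaAt_layer_of_tamagawaWitnesses` (`hres`; `[NumberField (κ.layer n)]` a BINDER per
the cell convention R5-51 (c) — any instance, e.g. `ZpExtension.numberField_layer`, discharges it):
for every layer `n` there is a restricted tower `κ'` of `K_n` (`ZpTower.exists_restrictTower`) and an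
INJECTIVE homomorphism `Sel_{p^∞}(E_{K_n}/K_{n,∞}) →+ Sel_{p^∞}(E/K_∞)`. [cite: Mazur1972, §6] -/
theorem exists_selmerInfty_restrictTower_injective [NumberField (κ.layer n)] :
    ∃ κ' : ZpExtension (κ.layer n) p,
      (∀ σ : Field.absoluteGaloisGroup (κ.layer n),
          (κ' σ).toAdd * (p : ℤ_[p]) ^ n = (κ (resGal (K := K) (κ.layer n) σ)).toAdd) ∧
        ∃ f : (W.baseChange (κ.layer n)).selmerInfty κ' →+ W.selmerInfty κ,
          Function.Injective f := by
  obtain ⟨κ', hκ'⟩ := exists_restrictTower κ n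
  exact ⟨κ', hκ', selmerInftyOfRestrictTower W κ n κ' hκ',
    selmerInftyOfRestrictTower_injective W κ n κ' hκ'⟩

end Summit.BirchSwinnertonDyer.Rank1Residual.Additive.ZpTower

end
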